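import Literature.Geometry.Manifold.TopologicalEmbedding
import Mathlib.Geometry.Manifold.Instances.Real
import HarnessLib

/-!
# Compact topological manifolds with boundary embed in Euclidean space

Topic `Literature/Geometry/Manifold`, sibling proof file of `TopologicalEmbedding.lean`, which
proves (Hatcher, *Algebraic Topology* (2002), Appendix, proof of Cor. A.9, p. 527: "a compact
manifold `M` can be embedded in `ℝᵏ` for some `k`") that a compact Hausdorff space with an atlas
of charts into a real normed space `H` embeds in some `ℝᴺ`
(`Literature.Geometry.Manifold.exists_isClosedEmbedding_pi_of_compactSpace`).  Hatcher's Cor. A.9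
is stated "with or without boundary"; the charts of a manifold with boundary take values in the
half-space `EuclideanHalfSpace n = {x : ℝⁿ // 0 ≤ x 0}`, which is not a normed space, so the
boundary case is not literally covered there.  This file PROVES it, by the same partition-of-unity
argument run through a continuous injection `ι : H → E` of the model space into a normed space:

* `Literature.Geometry.Manifold.exists_continuous_injective_of_compactSpace_of_injective`: a compact
  Hausdorff space with an atlas of charts into a topological space `H` that injects continuously
  into a real normed space `E` admits a continuous injection into a finite product `ι → E × ℝ`;
* `Literature.Geometry.Manifold.exists_isClosedEmbedding_pi_of_compactSpace_of_injective`: if `E` is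
  finite dimensional, a closed embedding into some `Fin N → ℝ`;
* `Literature.Geometry.Manifold.exists_isClosedEmbedding_pi_of_compactSpace_halfSpace`,
  `…_euclideanSpace_of_compactSpace_halfSpace`: compact topological `n`-manifolds with boundary
  (charts into `EuclideanHalfSpace n`, `ι = Subtype.val`) embed in `Fin N → ℝ`, resp.
  `EuclideanSpace ℝ (Fin N)`.

Proof (as in `TopologicalEmbedding.lean`): finitely many chart domains `Uᵢ` cover `M`; shrink to
a closed cover `Cᵢ ⊆ Uᵢ`; Urysohn functions `λᵢ` (`= 1` on `Cᵢ`, `= 0` off `Uᵢ`); the chart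
read in `E` through `ι` is made bounded by `E ≃ ball 0 1` and extended by `0`; then
`F(x) = (λᵢ(x) • φᵢ(x), λᵢ(x))ᵢ` is continuous and injective, hence a closed embedding of the
compact `M` into the Hausdorff `ι → E × ℝ ≃ ℝᴺ`.  No `sorry`, no named-fact hypotheses, no new
definitions.

## References

* A. Hatcher, *Algebraic Topology*, CUP (2002), Appendix, Cor. A.9 ("Every compact manifold, with
  or without boundary, is an ENR") and its proof (p. 527). [HatcherAT2002]
-/

noncomputable section

open Set Function Filter Topology

namespace Literature.Geometry.Manifold

section Embedding

variable {M : Type*} [TopologicalSpace M] [T2Space M] [CompactSpace M]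

/-- **A compact space with charts into a model that injects continuously into a normed space
injects continuously into a finite product `ι → E × ℝ`** (Hatcher 2002, proof of Cor. A.9, via
a partition of unity; the version of
`Literature.Geometry.Manifold.exists_continuous_injective_of_compactSpace` for an arbitrary
topological model space `H` with a continuous injection `ι : H → E`, e.g. the half-space of a
manifold with boundary): with finitely many charts `φᵢ` covering `M`, a shrinking `Cᵢ ⊆ Uᵢ` and
Urysohn functions `λᵢ`, the map `x ↦ (λᵢ(x) • b(ι(φᵢ x)), λᵢ(x))ᵢ` (`b : E ≃ ball 0 1`, extended
by `0` off `Uᵢ`) is continuous and injective. [cite: HatcherAT2002, proof of Cor. A.9] -/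
theorem exists_continuous_injective_of_compactSpace_of_injective {H : Type*} [TopologicalSpace H]
    [ChartedSpace H M] {E : Type*} [NormedAddCommGroup E] [NormedSpace ℝ E] (ι : H → E)
    (hι : Continuous ι) (hinj : Injective ι) :
    ∃ (t : Finset M) (f : M → (↥t → E × ℝ)), Continuous f ∧ Injective f := by
  classical
  -- finitely many chart domains cover `M`
  obtain ⟨t, ht⟩ : ∃ t : Finset M, (univ : Set M) ⊆ ⋃ p ∈ t, (chartAt H p).source :=
    isCompact_univ.elim_finite_subcover (fun p : M => (chartAt H p).source)
      (fun p => (chartAt H p).open_source) (fun p _ => mem_iUnion.2 ⟨p, mem_chart_source H p⟩)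
  set u : ↥t → Set M := fun i => (chartAt H (i : M)).source with hu
  have huo : ∀ i, IsOpen (u i) := fun i => (chartAt H (i : M)).open_source
  have hcov : ⋃ i, u i = univ := by
    refine univ_subset_iff.1 fun x _ => ?_
    obtain ⟨p, hp, hx⟩ := mem_iUnion₂.1 (ht (mem_univ x))
    exact mem_iUnion.2 ⟨⟨p, hp⟩, hx⟩
  -- shrink to a closed cover
  obtain ⟨v, hvcov, hvc, hvu⟩ :=
    exists_iUnion_eq_closed_subset huo (fun x => Set.toFinite _) hcov
  -- Urysohn functions
  have hlam : ∀ i, ∃ g : C(M, ℝ), EqOn g 0 (u i)ᶜ ∧ EqOn g 1 (v i) ∧ ∀ x, g x ∈ Icc (0 : ℝ) 1 :=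
    fun i => exists_continuous_zero_one_of_isClosed (huo i).isClosed_compl (hvc i)
      (disjoint_compl_left_iff_subset.2 (hvu i))
  choose lam hlam0 hlam1 hlam01 using hlam
  -- bounded charts read in `E`, extended by `0`
  set φ : ↥t → M → E := fun i x =>
    if x ∈ u i then OpenPartialHomeomorph.univUnitBall (ι (chartAt H (i : M) x)) else 0 with hφ
  have hφmem : ∀ i x, x ∈ u i →
      φ i x = OpenPartialHomeomorph.univUnitBall (ι (chartAt H (i : M) x)) :=
    fun i x hx => by simp [hφ, hx]
  have hφnot : ∀ i x, x ∉ u i → φ i x = 0 := fun i x hx => by simp [hφ, hx]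
  have hφnorm : ∀ i x, ‖φ i x‖ ≤ 1 := by
    intro i x
    by_cases hx : x ∈ u i
    · rw [hφmem i x hx]
      have h := OpenPartialHomeomorph.univUnitBall.map_source (x := ι (chartAt H (i : M) x))
        (mem_univ _)
      rw [OpenPartialHomeomorph.univUnitBall_target, mem_ball_zero_iff] at h
      exact h.le
    · rw [hφnot i x hx, norm_zero]
      exact zero_le_one
  have hφcont : ∀ i, ContinuousOn (φ i) (u i) := by
    intro i
    have h1 : Continuous (OpenPartialHomeomorph.univUnitBall : E → E) :=
      continuousOn_univ.1 (OpenPartialHomeomorph.univUnitBall (E := E)).continuousOn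
    refine ((h1.comp hι).comp_continuousOn (chartAt H (i : M)).continuousOn).congr ?_
    intro x hx
    simp [hφmem i x hx]
  have hφinj : ∀ i, InjOn (φ i) (u i) := by
    intro i x hx y hy hxy
    rw [hφmem i x hx, hφmem i y hy] at hxy
    have h1 : ι (chartAt H (i : M) x) = ι (chartAt H (i : M) y) :=
      (OpenPartialHomeomorph.univUnitBall (E := E)).injOn (mem_univ _) (mem_univ _) hxy
    exact (chartAt H (i : M)).injOn hx hy (hinj h1)
  -- the map
  refine ⟨t, fun x i => (lam i x • φ i x, lam i x), ?_, ?_⟩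
  · -- continuity
    refine continuous_pi fun i => Continuous.prodMk ?_ (lam i).continuous
    refine continuous_iff_continuousAt.2 fun x => ?_
    by_cases hx : x ∈ u i
    · have hon : ContinuousOn (fun y => lam i y • φ i y) (u i) :=
        (lam i).continuous.continuousOn.smul (hφcont i)
      exact hon.continuousAt ((huo i).mem_nhds hx)
    · have h0 : lam i x = 0 := hlam0 i hx
      rw [ContinuousAt, h0, zero_smul]
      refine tendsto_zero_iff_norm_tendsto_zero.2
        (squeeze_zero (g := fun y => ‖lam i y‖) (fun y => norm_nonneg _) (fun y => ?_) ?_)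
      · rw [norm_smul]
        exact mul_le_of_le_one_right (norm_nonneg _) (hφnorm i y)
      · have h := ((lam i).continuous.tendsto x).norm
        rwa [h0, norm_zero] at h
  · -- injectivity
    intro x y hxy
    obtain ⟨i, hi⟩ : ∃ i, x ∈ v i := by
      have hx : x ∈ ⋃ i, v i := by rw [hvcov]; exact mem_univ x
      exact mem_iUnion.1 hx
    have h := congr_fun hxy i
    simp only [Prod.mk.injEq] at h
    have hx1 : lam i x = 1 := hlam1 i hi
    have hy1 : lam i y = 1 := by rw [← h.2, hx1]
    have hyu : y ∈ u i := by
      by_contra hyu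
      have := hlam0 i hyu
      simp only [Pi.zero_apply] at this
      rw [this] at hy1
      exact zero_ne_one hy1
    have hb : φ i x = φ i y := by
      have h1 := h.1
      rwa [hx1, hy1, one_smul, one_smul] at h1
    exact hφinj i (hvu i hi) hyu hb

/-- **Compact spaces with charts into a model injecting into a finite-dimensional normed space
embed in Euclidean space** (Hatcher 2002, proof of Cor. A.9: "a continuous injection `M ↪ ℝᵏ`,
and this is a homeomorphism onto its image since `M` is compact"): a closed embedding into
`Fin N → ℝ`, `N = dim (ι → E × ℝ)`. [cite: HatcherAT2002, Cor. A.9 (proof)] -/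
theorem exists_isClosedEmbedding_pi_of_compactSpace_of_injective {H : Type*} [TopologicalSpace H]
    [ChartedSpace H M] {E : Type*} [NormedAddCommGroup E] [NormedSpace ℝ E] [FiniteDimensional ℝ E]
    (ι : H → E) (hι : Continuous ι) (hinj : Injective ι) :
    ∃ (N : ℕ) (f : M → (Fin N → ℝ)), IsClosedEmbedding f := by
  obtain ⟨t, F, hFc, hFi⟩ :=
    exists_continuous_injective_of_compactSpace_of_injective (M := M) ι hι hinj
  set N := Module.finrank ℝ (↥t → E × ℝ) with hN
  have e : (↥t → E × ℝ) ≃L[ℝ] (Fin N → ℝ) :=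
    ContinuousLinearEquiv.ofFinrankEq (by rw [Module.finrank_fin_fun])
  exact ⟨N, e ∘ F, (e.continuous.comp hFc).isClosedEmbedding (e.injective.comp hFi)⟩

/-- **Compact topological manifolds with boundary embed in Euclidean space** (Hatcher 2002,
Cor. A.9 and its proof, "with or without boundary"): a compact Hausdorff space with an atlas of
charts into the half-space `EuclideanHalfSpace n` (the tree's compact topological `n`-manifolds
with boundary, e.g. `[ChartedSpace (EuclideanHalfSpace (n + 1)) W]` in
`Literature/AlgebraicTopology/SingularHomology/LefschetzDuality.lean`) admits a closed embedding
into some `Fin N → ℝ`. [cite: HatcherAT2002, Cor. A.9 (proof)] -/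
theorem exists_isClosedEmbedding_pi_of_compactSpace_halfSpace (n : ℕ) [NeZero n]
    [i : ChartedSpace (EuclideanHalfSpace n) M] :
    ∃ (N : ℕ) (f : M → (Fin N → ℝ)), IsClosedEmbedding f :=
  -- the instance is passed explicitly: unification with `Subtype.val` reads the topology of
  -- `EuclideanHalfSpace n` as the subtype topology, under which instance search does not
  -- recognise the (definitionally equal) derived instance
  @exists_isClosedEmbedding_pi_of_compactSpace_of_injective M _ _ _ (EuclideanHalfSpace n) _ i
    (EuclideanSpace ℝ (Fin n)) _ _ _ Subtype.val continuous_subtype_val Subtype.val_injective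

/-- **Compact topological manifolds with boundary embed in Euclidean space**,
`EuclideanSpace ℝ (Fin N)` version of `exists_isClosedEmbedding_pi_of_compactSpace_halfSpace`.
[cite: HatcherAT2002, Cor. A.9 (proof)] -/
theorem exists_isClosedEmbedding_euclideanSpace_of_compactSpace_halfSpace (n : ℕ) [NeZero n]
    [ChartedSpace (EuclideanHalfSpace n) M] :
    ∃ (N : ℕ) (f : M → EuclideanSpace ℝ (Fin N)), IsClosedEmbedding f := by
  obtain ⟨N, f, hf⟩ := exists_isClosedEmbedding_pi_of_compactSpace_halfSpace (M := M) n
  refine ⟨N, (EuclideanSpace.equiv (Fin N) ℝ).symm ∘ f, ?_⟩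
  exact (EuclideanSpace.equiv (Fin N) ℝ).symm.toHomeomorph.isClosedEmbedding.comp hf

end Embedding

end Literature.Geometry.Manifold

end
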